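import Summits.Ventures.HodgeRepro2.T6N3Interface

/-!
# T6N3Decomp — the direct-sum decomposition of `𝒱 = ⊕ σ′_f` and the `G(𝔸_f)`-span (N3.L8 (1)–(3), part 1)

Cell pub-hodge-repro2, Tier 6 (README §10), seat t6-p3 (N3 owner, M2). Record: TIER5 §N3.4, N3.L8
(«ASSEMBLY: both sides ⟹ (N)»), steps (1)–(4), over the datum `N3Datum` (T6N3Datum) with the
interface Props of T6N3Interface as binders.

Content (part 1 of N3.L8; part 2 = T6N3Iso.lean). `𝒱 = ⊕_{σ′} σ′_f` (`V20`, the τ-parts of the τ-type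
automorphic `σ′`, pairwise orthogonal — `AutOrthogonal` — hence a direct sum): every `x ∈ 𝒱` has a
unique decomposition `x = Σ comp i x` with `comp i x ∈ σ′_i` (§1); the components are linear and
`G(𝔸_f)`-equivariant (§2); stable subspaces and the `G(𝔸_f)`-span `rhoSpan x` (the smallest stable
subspace containing `x` — an `sInf`, so no group law on `G(𝔸_f)` is needed) (§3).

§8(d): uses an L-value-free non-vanishing device: NO.
-/

namespace Summit.Ventures.HodgeRepro2.T6.N3Datum

open scoped InnerProductSpace

variable (𝒟 : N3Datum)

/-! ## 1. The direct-sum decomposition of `𝒱` -/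

/-- The τ-part `σ′_f = σ′ ⊓ τiso` of the automorphic subrepresentation `σ′ = aut i` (N3.L8 (1)). -/
abbrev tauPart (i : 𝒟.Aut) : Submodule ℂ 𝒟.LG := 𝒟.aut i ⊓ 𝒟.τiso

/-- A decomposition of `x` along the τ-parts: a finitely supported family `f` with `f i ∈ σ′_i` and
`Σ_i f i = x`. -/
def IsDecomp (x : 𝒟.LG) (f : 𝒟.Aut →₀ 𝒟.LG) : Prop :=
  (∀ i, f i ∈ 𝒟.tauPart i) ∧ (f.sum fun _ m => m) = x

/-- Every element of `𝒱` has a decomposition along the τ-parts. -/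
lemma exists_isDecomp {x : 𝒟.LG} (hx : x ∈ 𝒟.V20) : ∃ f, 𝒟.IsDecomp x f :=
  (Submodule.mem_iSup_iff_exists_finsupp _ x).mp hx

/-- Uniqueness of the decomposition (the τ-parts of distinct `σ′` are orthogonal). -/
lemma isDecomp_unique (hO : 𝒟.AutOrthogonal) {x : 𝒟.LG} {f g : 𝒟.Aut →₀ 𝒟.LG}
    (hf : 𝒟.IsDecomp x f) (hg : 𝒟.IsDecomp x g) : f = g := by
  classical
  have hdi : ∀ i, (f - g) i ∈ 𝒟.tauPart i := fun i => by
    rw [Finsupp.sub_apply]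
    exact sub_mem (hf.1 i) (hg.1 i)
  have hsum : ((f - g).sum fun _ m => m) = 0 := by
    rw [Finsupp.sum_sub_index (fun _ _ _ => rfl), hf.2, hg.2, sub_self]
  have h0 : ∀ i, (f - g) i = 0 := by
    intro i
    have h1 : ⟪(f - g) i, (f - g).sum fun _ m => m⟫_ℂ = 0 := by rw [hsum, inner_zero_right]
    rw [Finsupp.sum, inner_sum] at h1
    by_cases hi : i ∈ (f - g).support
    · rw [Finset.sum_eq_single i] at h1
      · exact inner_self_eq_zero.mp h1
      · intro j _ hji
        exact hO i j (Ne.symm hji) _ (hdi i).1 _ (hdi j).1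
      · intro h
        exact absurd hi h
    · exact Finsupp.notMem_support_iff.mp hi
  exact sub_eq_zero.mp (Finsupp.ext h0)

open Classical in
/-- A chosen decomposition of `x` (zero off `𝒱`). -/
noncomputable def decomp (x : 𝒟.LG) : 𝒟.Aut →₀ 𝒟.LG :=
  if hx : x ∈ 𝒟.V20 then Classical.choose (𝒟.exists_isDecomp hx) else 0

/-- The chosen decomposition is a decomposition. -/
lemma isDecomp_decomp {x : 𝒟.LG} (hx : x ∈ 𝒟.V20) : 𝒟.IsDecomp x (𝒟.decomp x) := by
  unfold decomp
  rw [dif_pos hx]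
  exact Classical.choose_spec (𝒟.exists_isDecomp hx)

/-- The `i`-th component of `x ∈ 𝒱`: the `σ′_i`-part of its decomposition. -/
noncomputable def comp (i : 𝒟.Aut) (x : 𝒟.LG) : 𝒟.LG := 𝒟.decomp x i

/-- The components are read off any decomposition (uniqueness). -/
lemma comp_eq_of_isDecomp (hO : 𝒟.AutOrthogonal) {x : 𝒟.LG} {f : 𝒟.Aut →₀ 𝒟.LG}
    (hf : 𝒟.IsDecomp x f) (hx : x ∈ 𝒟.V20) (i : 𝒟.Aut) : 𝒟.comp i x = f i := by
  unfold comp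
  rw [𝒟.isDecomp_unique hO (𝒟.isDecomp_decomp hx) hf]

/-- The `i`-th component lies in `σ′_i`. -/
lemma comp_mem {x : 𝒟.LG} (hx : x ∈ 𝒟.V20) (i : 𝒟.Aut) : 𝒟.comp i x ∈ 𝒟.tauPart i :=
  (𝒟.isDecomp_decomp hx).1 i

/-- `x` is the sum of its components over the support of its decomposition. -/
lemma sum_comp {x : 𝒟.LG} (hx : x ∈ 𝒟.V20) :
    ∑ i ∈ (𝒟.decomp x).support, 𝒟.comp i x = x :=
  (𝒟.isDecomp_decomp hx).2

/-- A component outside the support vanishes. -/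
lemma comp_eq_zero_of_notMem_support {x : 𝒟.LG} {i : 𝒟.Aut} (hi : i ∉ (𝒟.decomp x).support) :
    𝒟.comp i x = 0 :=
  Finsupp.notMem_support_iff.mp hi

/-- The support of the decomposition = the indices of the non-zero components. -/
lemma mem_support_iff_comp_ne_zero {x : 𝒟.LG} {i : 𝒟.Aut} :
    i ∈ (𝒟.decomp x).support ↔ 𝒟.comp i x ≠ 0 :=
  Finsupp.mem_support_iff

/-! ## 2. Linearity and equivariance of the components -/

/-- The components are additive on `𝒱`. -/
lemma comp_add (hO : 𝒟.AutOrthogonal) {x y : 𝒟.LG} (hx : x ∈ 𝒟.V20) (hy : y ∈ 𝒟.V20) (i : 𝒟.Aut) :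
    𝒟.comp i (x + y) = 𝒟.comp i x + 𝒟.comp i y := by
  have hd : 𝒟.IsDecomp (x + y) (𝒟.decomp x + 𝒟.decomp y) := by
    refine ⟨fun j => ?_, ?_⟩
    · rw [Finsupp.add_apply]
      exact add_mem (𝒟.comp_mem hx j) (𝒟.comp_mem hy j)
    · rw [Finsupp.sum_add_index' (fun _ => rfl) (fun _ _ _ => rfl), (𝒟.isDecomp_decomp hx).2,
        (𝒟.isDecomp_decomp hy).2]
  rw [𝒟.comp_eq_of_isDecomp hO hd (add_mem hx hy) i, Finsupp.add_apply]
  rfl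

/-- The components are ℂ-homogeneous on `𝒱`. -/
lemma comp_smul (hO : 𝒟.AutOrthogonal) {x : 𝒟.LG} (hx : x ∈ 𝒟.V20) (c : ℂ) (i : 𝒟.Aut) :
    𝒟.comp i (c • x) = c • 𝒟.comp i x := by
  have hd : 𝒟.IsDecomp (c • x) (c • 𝒟.decomp x) := by
    refine ⟨fun j => ?_, ?_⟩
    · rw [Finsupp.smul_apply]
      exact Submodule.smul_mem _ c (𝒟.comp_mem hx j)
    · rw [Finsupp.sum_smul_index' (fun _ => rfl), ← Finsupp.smul_sum, (𝒟.isDecomp_decomp hx).2]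
  rw [𝒟.comp_eq_of_isDecomp hO hd (Submodule.smul_mem _ c hx) i, Finsupp.smul_apply]
  rfl

/-- `𝒱` is `G(𝔸_f)`-stable (each τ-part is). -/
lemma V20_stable (hst : 𝒟.AutStable) (g : 𝒟.Gf) {x : 𝒟.LG} (hx : x ∈ 𝒟.V20) :
    𝒟.ρ g x ∈ 𝒟.V20 := by
  rw [← 𝒟.sum_comp hx, map_sum]
  refine Submodule.sum_mem _ fun i _ => ?_
  exact Submodule.mem_iSup_of_mem i (hst i g _ (𝒟.comp_mem hx i))

/-- The components are `G(𝔸_f)`-equivariant on `𝒱` (each τ-part is stable). -/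
lemma comp_rho (hO : 𝒟.AutOrthogonal) (hst : 𝒟.AutStable) {x : 𝒟.LG} (hx : x ∈ 𝒟.V20)
    (g : 𝒟.Gf) (i : 𝒟.Aut) : 𝒟.comp i (𝒟.ρ g x) = 𝒟.ρ g (𝒟.comp i x) := by
  have hd : 𝒟.IsDecomp (𝒟.ρ g x)
      (Finsupp.mapRange (𝒟.ρ g) (map_zero _) (𝒟.decomp x)) := by
    refine ⟨fun j => ?_, ?_⟩
    · rw [Finsupp.mapRange_apply]
      exact hst j g _ (𝒟.comp_mem hx j)
    · rw [Finsupp.sum_mapRange_index (fun _ => rfl), Finsupp.sum, ← map_sum]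
      exact congrArg (𝒟.ρ g) (𝒟.sum_comp hx)
  rw [𝒟.comp_eq_of_isDecomp hO hd (𝒟.V20_stable hst g hx) i, Finsupp.mapRange_apply]
  rfl

/-- An element of a τ-part is its own `i`-th component and has no other component. -/
lemma comp_of_mem_tauPart (hO : 𝒟.AutOrthogonal) {i : 𝒟.Aut} {x : 𝒟.LG} (hx : x ∈ 𝒟.tauPart i) :
    𝒟.comp i x = x ∧ ∀ j, j ≠ i → 𝒟.comp j x = 0 := by
  classical
  have hxV : x ∈ 𝒟.V20 := Submodule.mem_iSup_of_mem i hx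
  have hd : 𝒟.IsDecomp x (Finsupp.single i x) := by
    refine ⟨fun j => ?_, ?_⟩
    · by_cases hji : j = i
      · subst hji
        rw [Finsupp.single_eq_same]
        exact hx
      · rw [Finsupp.single_eq_of_ne hji]
        exact Submodule.zero_mem _
    · rw [Finsupp.sum_single_index rfl]
  refine ⟨?_, fun j hji => ?_⟩
  · rw [𝒟.comp_eq_of_isDecomp hO hd hxV i, Finsupp.single_eq_same]
  · rw [𝒟.comp_eq_of_isDecomp hO hd hxV j, Finsupp.single_eq_of_ne hji]

/-! ## 3. Stable subspaces, the `G(𝔸_f)`-span, and the isotypic decomposition (N3.L8 (3)) -/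

/-- A `G(𝔸_f)`-stable subspace of `L²([G])`. -/
def IsStable (N : Submodule ℂ 𝒟.LG) : Prop :=
  ∀ g : 𝒟.Gf, ∀ x ∈ N, 𝒟.ρ g x ∈ N

/-- `𝒱` is stable. -/
lemma isStable_V20 (hst : 𝒟.AutStable) : 𝒟.IsStable 𝒟.V20 :=
  fun g _ hx => 𝒟.V20_stable hst g hx

/-- Each τ-part is stable (`AutStable`). -/
lemma isStable_tauPart (hst : 𝒟.AutStable) (i : 𝒟.Aut) : 𝒟.IsStable (𝒟.tauPart i) :=
  fun g _ hx => hst i g _ hx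

/-- The intersection of two stable subspaces is stable. -/
lemma isStable_inf {N N' : Submodule ℂ 𝒟.LG} (hN : 𝒟.IsStable N) (hN' : 𝒟.IsStable N') :
    𝒟.IsStable (N ⊓ N') :=
  fun g _ hx => ⟨hN g _ hx.1, hN' g _ hx.2⟩

/-- The `G(𝔸_f)`-span of `x`: the smallest stable subspace containing `x`. -/
def rhoSpan (x : 𝒟.LG) : Submodule ℂ 𝒟.LG :=
  sInf {N : Submodule ℂ 𝒟.LG | x ∈ N ∧ 𝒟.IsStable N}

/-- `x` lies in its own `G(𝔸_f)`-span. -/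
lemma mem_rhoSpan (x : 𝒟.LG) : x ∈ 𝒟.rhoSpan x :=
  Submodule.mem_sInf.mpr fun _ hN => hN.1

/-- The `G(𝔸_f)`-span is stable. -/
lemma isStable_rhoSpan (x : 𝒟.LG) : 𝒟.IsStable (𝒟.rhoSpan x) := by
  intro g y hy
  rw [rhoSpan, Submodule.mem_sInf] at hy ⊢
  intro N hN
  exact hN.2 g y (hy N hN)

/-- The `G(𝔸_f)`-span of `x` lies in every stable subspace containing `x`. -/
lemma rhoSpan_le {x : 𝒟.LG} {N : Submodule ℂ 𝒟.LG} (hx : x ∈ N) (hN : 𝒟.IsStable N) :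
    𝒟.rhoSpan x ≤ N :=
  sInf_le ⟨hx, hN⟩

/-- The `G(𝔸_f)`-span of a non-zero vector is non-zero. -/
lemma rhoSpan_ne_bot {x : 𝒟.LG} (hx : x ≠ 0) : 𝒟.rhoSpan x ≠ ⊥ := by
  intro h
  have := 𝒟.mem_rhoSpan x
  rw [h, Submodule.mem_bot] at this
  exact hx this

end Summit.Ventures.HodgeRepro2.T6.N3Datum
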